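import Mathlib
import Summits.Ventures.FusionMHD.Models.SAlphaStableS25A146875
import Summits.Ventures.FusionMHD.Bench.BallooningSAlphaEndMoveS25A15
import HarnessLib

/-!
# F3 — FOURTH-ROUND HALF-GAP END MOVE AT SHEAR `s = 5/2` (JOINT, both cells already in the tree, BY NAME): the first-stability edge of the
# `s–α` MODEL at `s = 5/2` lies in `[47/32, 3/2]` (width `1/32` = HALF of `[23/16, 3/2]`, width `1/16`, the third-round row on p639520)
(venture LADDER-GRIDFUSION, rung F3; cell `gridfusion`; gridfusion-model-7 (g10), 2026-08-28.  DIRECTOR RULING 67 (3): one count per halving per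
shear; LOWER cell = gridfusion-lit-4 (g13)'s `SAlphaStableS25A146875.stableSide : SAlpha.StableSide (5/2) (47/32)` (Sturm/Taylor-model core + tail,
landed 2026-08-28 for this pairing, INBOX I4387); UPPER cell = gridfusion-model-7 (g10)'s third-round spline witness
`Bench/BallooningSAlphaEndMoveS25A15` — `SAlphaS25W15.unstableWitness_band : ∀ α ∈ Icc (3/2) (25/16), UnstableWitness (5/2) α (−32) 32 X X′`
(lit-3's finite-element lane), whose left end is `3/2`.  THIS file only CONJOINS the two (0 `decide`, 0 kit, no `native_decide`).)

## THREE COLUMNS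
CERTIFIED: in the `s–α` ballooning MODEL (Freidberg (12.96)–(12.99), `θ₀ = 0`) at shear `s = 5/2`: `47/32 ∉ U_{5/2}` and `3/2 ∈ U_{5/2}`
(`U_s` = the `α` at which some compact window carries a `C¹` trial function of negative one-surface energy) ⇒ `inf {α ≥ 47/32 : α ∈ U_{5/2}} ∈ [47/32, 3/2]`
CLOSED, width `1/32`.  Monotonicity / continuity of the edge in `α` NOT typed.  VALIDATED (not in the kernel): float E–L shooting edge `α ≈ 1.49 (1.486)`
(lit-4 kit j299948 / lit-3 `edges.py`).  MODELLED: `s–α` model (large-aspect-ratio shifted circles, high-`n` ballooning ordering, `θ₀ = 0`, ideal MHD);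
no device, no `β`-limit.  Citations: Freidberg 2014 §12.3 (12.38)–(12.40), §12.6.2 (12.96)–(12.100) [Freidberg2014].
-/

open Literature.MathematicalPhysics.MHD.Ballooning Literature.MathematicalPhysics.MHD.Ballooning.SAlpha
open Set

namespace Summit.Ventures.FusionMHD.Bench.SAlphaEndMoveS25R4

/-- ★★★ THE FOURTH-ROUND HALF-GAP END MOVE AT `s = 5/2`: `47/32` is on the STABLE side (gridfusion-lit-4's `SAlphaStableS25A146875.stableSide`, BY NAME)
and `3/2` is NOT (gridfusion-model-7's `SAlphaS25W15.unstableWitness_band`, BY NAME) — the first-stability edge of the MODEL at `s = 5/2` lies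
in the closed interval `[47/32, 3/2]` of width `1/32`. [cite: Freidberg2014, §12.3 eqs. (12.38)–(12.40)] -/
theorem endMove_fiveHalves_fourth : StableSide (5/2) (47/32) ∧ ¬ StableSide (5/2) (3/2) :=
  ⟨Summit.Ventures.FusionMHD.Models.SAlphaStableS25A146875.stableSide,
   Summit.Ventures.FusionMHD.Bench.SAlphaS25W15.not_stableSide_of_mem_band ⟨le_rfl, by norm_num⟩⟩

/-- The same bracket as a membership statement for the UPPER end: some window carries a witness at `(5/2, 3/2)`.
[cite: Freidberg2014, §12.3 eqs. (12.38)–(12.40)] -/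
theorem exists_unstableWitness_upper : ∃ a b : ℝ, ∃ X X' : ℝ → ℝ, UnstableWitness (5/2) (3/2) a b X X' :=
  Summit.Ventures.FusionMHD.Bench.SAlphaS25W15.exists_unstableWitness_of_mem_band ⟨le_rfl, by norm_num⟩

end Summit.Ventures.FusionMHD.Bench.SAlphaEndMoveS25R4
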